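/-
Copyright (c) 2026. All rights reserved.
Released under Apache 2.0 license as described in the file LICENSE.
-/
import Mathlib
import HarnessLib
import Literature.Analysis.Complex.RoucheTheorem
import Summits.RiemannHypothesis.RiemannHypothesis.Theses.EarlyAppointments
import Summits.RiemannHypothesis.RiemannHypothesis.Theorems.EarlyAppointmentsCombGHelpers

/-!
# Rouché argument helpers for CombDescentStep

The critical point existence proof via Rouché's theorem.
-/

open Complex Real Set Filter Topology
open scoped BigOperators Topology ComplexConjugate

noncomputable section

namespace RoucheAux

/-- The function G(z) = g'(z)/g(z) where g = dslope f z₀. -/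
def G (f : ℂ → ℂ) (z₀ : ℂ) : ℂ → ℂ :=
  EarlyAppointmentsCombGHelpers.G f z₀

/-- The linear comparison function h₀(z) = 1 + (z - z₀) * G(z₀). -/
def h₀ (f : ℂ → ℂ) (z₀ : ℂ) (z : ℂ) : ℂ :=
  1 + (z - z₀) * G f z₀ z₀

/-- The zero of h₀ is at z₀ - 1/G(z₀). -/
theorem h₀_zero {f : ℂ → ℂ} {c : ℂ} (hG : G f c c ≠ 0) :
    h₀ f c (c - 1 / G f c c) = 0 := by
  unfold h₀
  field_simp
  ring

/-- h₀ is differentiable. -/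
theorem h₀_differentiable {f : ℂ → ℂ} {c : ℂ} :
    Differentiable ℂ (h₀ f c) := by
  unfold h₀
  apply Differentiable.add
  · exact differentiable_const 1
  · exact (differentiable_id.sub (differentiable_const c)).mul (differentiable_const _)

/-- deriv h₀ = G f c c everywhere. -/
theorem h₀_deriv_eq {f : ℂ → ℂ} {c z : ℂ} :
    deriv (h₀ f c) z = G f c c := by
  have heq : h₀ f c = fun w => 1 + (w - c) * G f c c := rfl
  have heq2 : h₀ f c = fun w => (G f c c) * w + (1 - c * G f c c) := by
    ext w; unfold h₀; ring
  rw [heq2]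
  rw [deriv_add_const, deriv_const_mul _ differentiableAt_id, deriv_id'', mul_one]

/-- h₀ has a simple zero at c - 1/G(c). -/
theorem h₀_simple_zero {f : ℂ → ℂ} {c : ℂ} (hG : G f c c ≠ 0) :
    deriv (h₀ f c) (c - 1 / G f c c) ≠ 0 := by
  rw [h₀_deriv_eq]
  exact hG

/-- If |G(z₀)| > 2/r, then |z₀ - 1/G(z₀) - z₀| < r. -/
theorem h₀_zero_inside {f : ℂ → ℂ} {c : ℂ} {r : ℝ} (hr : 0 < r) (hG : G f c c ≠ 0)
    (hGbound : ‖G f c c‖ > 2 / r) :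
    ‖(c - 1 / G f c c) - c‖ < r := by
  simp only [sub_sub_cancel_left, norm_neg, one_div, norm_inv]
  have h1 : ‖G f c c‖ > 0 := norm_pos_iff.mpr hG
  -- ‖G‖⁻¹ < r iff ‖G‖ > r⁻¹ = 1/r
  rw [inv_lt_comm₀ h1 hr]
  have h2 : r⁻¹ < 2 / r := by
    rw [inv_eq_one_div]
    rw [div_lt_div_iff₀ hr hr]
    nlinarith
  linarith

end RoucheAux

end
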